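import Literature.Geometry.Lorentzian.ExtensionProofs
import Literature.Geometry.Lorentzian.AdiabaticTracking
import Summits.FinalStateConjecture.FinalStateConjecture.Statement
import Summits.FinalStateConjecture.FinalStateConjecture.Theorems.GapDecaySuffices.Negative.RelabelDecomposition
import Summits.FinalStateConjecture.FinalStateConjecture.Theorems.RenormalisedDriftDriftCaptureGlobalGaugePacking
import HarnessLib

/-!
# GLUING stub `stub_lateChartsOfPinnedTracking` of crux `DriftCapture` (stmt-FinalStateConjecture-17391),
# line `registered` (skeleton v4): the orthochronicity clause of its conclusion is free

The registered stub `stub_lateChartsOfPinnedTracking` of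
`Summits/FinalStateConjecture/FinalStateConjecture/Cruxes/DriftCapture/Lines/birth.lean` (ASSEMBLE's gluing
content on the live range `0 < N`, `m₀ ≤ 1`: EVENTUALLY pinned tracking by chains of `ε`-approximate
`N`-Kerr configurations of window length `1`, at every `δ > 0` and every accuracy, ⇒ `N + 1` late charts
with the thirteen packaging clauses consumed by `decomposition_of_lateCharts`, p151942) is research-level
(near-isometry rigidity of truncated Kerr / flat slabs, causal geometry of window images, patching along
accuracies `εₖ ↓ 0`; no tree API). This file lands the one piece of it that IS bookkeeping.

The hypothesis structure `ApproximateKerrConfiguration` pins no time orientation of its labels: a window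
chart of label `(Λ, c)` and the same map read over the label `(Λ T, c)` (`T` the time reversal) certify the
same region with the same slabs, so the pinned boosts `Λⱼ ∈ O(1,3)` handed to the gluing — and hence the
motions of whatever late charts it produces — may well be non-orthochronous, while the packaging theorem asks
`∀ i, IsOrthochronous (Λᵢ')` (clause 11; the geometric content of `IsFutureOriented` is in clauses 12–13,
the eventual future-direction of the pushed-forward background time vectors). We prove that clause 11 can
always be manufactured from the other twelve by RELABELLING, at no cost:

* `lateCharts_relabel` — Poincaré-relabelling covariance of the thirteen clauses: precomposing hole chart
  `i` with a model Poincaré map `Pᵢ x = Lᵢ x + pᵢ` and relabelling its motion `(Λᵢ, cᵢ) ↦ (Lᵢ⁻¹Λᵢ,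
  Lᵢ⁻¹(cᵢ − pᵢ))` (the landed calculus `Theorems.GapDecaySuffices.Negative.Relabel`: rest-frame time and
  radius transform by precomposition, chart images of model sets are unchanged, late charts stay late
  charts, `C²` norms on corresponding truncated slabs compare with a finite constant, the chain rule) keeps
  clauses 1–4, 6–10, 12–13, given that the rest-frame Kerr–Schild radius at flat points is unchanged
  (clause 5) and the new boosts are orthochronous (clause 11);
* `exists_orthochronous_conj`, `poincareInv_relabel_conj` — with `Lᵢ = Λᵢ Sᵢ Λᵢ⁻¹`, `pᵢ = cᵢ − Lᵢ cᵢ`,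
  `Sᵢ = 1` or `T` according as `Λᵢ` is orthochronous or not, the new rest-frame coordinates are `Sᵢ` of
  the old ones (so the Kerr–Schild radius is unchanged, `r ∘ T = r`) and the new boost `Λᵢ Sᵢ⁻¹` is
  orthochronous (`(Λ e₀)⁰ ≠ 0` on `O(1,3)`, `apply_basisVector_zero_ne_zero`);
* `lateCharts_orthochronous` — hence late-chart data satisfying the twelve clauses other than 11 can be
  relabelled into data satisfying all thirteen (same `O'`, `τ₀`, `ρ`, `U₀`, `Φ`, `R`, masses, spins);
* `decomposition_of_unorientedLateCharts` — `decomposition_of_lateCharts` without its orthochronicity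
  hypothesis;
* `lateChartsOfPinnedTracking_of_unoriented` — the registered stub follows VERBATIM from the same statement
  with clause 11 deleted from its conclusion (the sharper twelve-clause gluing statement is therefore an
  admissible replacement of the stub in the skeleton).

No definitions, no named facts, no `sorry`; the time reversal is the landed `C0Extension.timeReflect`.

References: O'Neill 1983, Ch. 9, pp. 233–236 (`O(1,3)`, its components, Poincaré motions); Kerr–Schild 1965
(Lorentz covariance of the Kerr–Schild ansatz); Dafermos–Holzegel–Rodnianski–Taylor arXiv:2104.08222, §1
(the `Cᵏ`-deviation gauge); Dafermos–Luk arXiv:1710.01722, Conjecture 1 (b)–(c).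
-/

set_option linter.dupNamespace false

noncomputable section

namespace Summit.FinalStateConjecture.FinalStateConjecture.Theorems.RenormalisedDrift.DriftCapture

open Set Filter Topology
open scoped Manifold ContDiff ENNReal
open Literature.Geometry.Lorentzian
open Summit.FinalStateConjecture.FinalStateConjecture.Theorems.GapDecaySuffices.Negative.Relabel

/-- A Lorentz transformation never maps the time axis into the hyperplane `{x⁰ = 0}`:
`(Λ e₀)⁰ ≠ 0` (indeed `((Λ e₀)⁰)² = 1 + |Λ e₀|²_{spatial}` from `η(Λ e₀, Λ e₀) = η(e₀, e₀) = −1`).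
O'Neill 1983, Ch. 9, p. 233. [cite: ONeill1983, Ch. 9  p. 233] -/
theorem apply_basisVector_zero_ne_zero (Λ : lorentzGroup) :
    (Λ : E4 ≃L[ℝ] E4) (E4.basisVector 0) 0 ≠ 0 := by
  have h := Λ.2 (E4.basisVector 0) (E4.basisVector 0)
  rw [Minkowski.bilin_basisVector_zero, Minkowski.bilin_apply] at h
  have hs : 0 ≤ ∑ i : Fin 3, (Λ : E4 ≃L[ℝ] E4) (E4.basisVector 0) i.succ *
      (Λ : E4 ≃L[ℝ] E4) (E4.basisVector 0) i.succ :=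
    Finset.sum_nonneg fun i _ ↦ mul_self_nonneg _
  intro h0
  rw [h0] at h
  linarith

/-- The time reversal `(x⁰, x̲) ↦ (−x⁰, x̲)` is an element of the Lorentz group `O(1,3)` (O'Neill 1983,
Ch. 9, p. 235: `O(1,3)` has four components, `T` lies in a non-orthochronous one). Existence form, the
element being `C0Extension.timeReflect`. [cite: ONeill1983, Ch. 9  p. 235] -/
theorem exists_timeReversal_mem_lorentzGroup : ∃ T : lorentzGroup, (∀ v, (T : E4 ≃L[ℝ] E4) v 0 = -v 0) ∧
    ∀ v, E4.spatial ((T : E4 ≃L[ℝ] E4) v) = E4.spatial v :=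
  ⟨⟨C0Extension.timeReflect, fun v w ↦ C0Extension.bilin_timeReflectCLM v w⟩,
    fun v ↦ C0Extension.timeReflectCLM_apply_zero v, fun v ↦ C0Extension.spatial_timeReflectCLM v⟩

/-- The Kerr–Schild radius `r(a, x)` only depends on the spatial part `x̲` of `x` (it solves
`r⁴ − (|x̲|² − a²) r² − a² (x³)² = 0`). Visser arXiv:0706.0622, (35). [cite: arXiv07060622, (35)] -/
theorem kerrRadius_eq_of_spatial_eq (a : ℝ) {v w : E4} (h : E4.spatial v = E4.spatial w) :
    Kerr.radius a v = Kerr.radius a w := by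
  have h3 : v 3 = w 3 := by
    have := congrArg (fun z : E3 ↦ z 2) h
    simpa [E4.spatial_apply] using this
  unfold Kerr.radius E4.spatialNorm
  rw [h, h3]

/-- **Orthochronous representative of a boost label.** For every `Λ ∈ O(1,3)` there is a discrete
element `S ∈ {1, T}` (`T` the time reversal) which preserves the Kerr–Schild radius of every spin and such
that the RELABELLED boost `(Λ S Λ⁻¹)⁻¹ Λ = Λ S⁻¹` is orthochronous: `S = 1` if `Λ` already is, `S = T`
otherwise (then `(Λ T e₀)⁰ = −(Λ e₀)⁰ > 0`, as `(Λ e₀)⁰ ≠ 0`). O'Neill 1983, Ch. 9, pp. 233–236.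
[cite: ONeill1983, Ch. 9  pp. 233–236] -/
theorem exists_orthochronous_conj (Λ : lorentzGroup) :
    ∃ S : lorentzGroup, (∀ (a : ℝ) (y : E4), Kerr.radius a ((S : E4 ≃L[ℝ] E4) y) = Kerr.radius a y) ∧
      Summit.FinalStateConjecture.IsOrthochronous ((Λ * S * Λ⁻¹)⁻¹ * Λ) := by
  -- the relabelled boost applied to `e₀` is `Λ (S⁻¹ e₀)`
  have key : ∀ S : lorentzGroup, (((Λ * S * Λ⁻¹)⁻¹ * Λ : lorentzGroup) : E4 ≃L[ℝ] E4) (E4.basisVector 0) =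
      (Λ : E4 ≃L[ℝ] E4) ((S : E4 ≃L[ℝ] E4).symm (E4.basisVector 0)) := by
    intro S
    show ((Λ * S * Λ⁻¹ : lorentzGroup) : E4 ≃L[ℝ] E4).symm ((Λ : E4 ≃L[ℝ] E4) (E4.basisVector 0)) = _
    rw [ContinuousLinearEquiv.symm_apply_eq]
    show _ = (Λ : E4 ≃L[ℝ] E4) ((S : E4 ≃L[ℝ] E4) ((Λ : E4 ≃L[ℝ] E4).symm
      ((Λ : E4 ≃L[ℝ] E4) ((S : E4 ≃L[ℝ] E4).symm (E4.basisVector 0)))))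
    rw [ContinuousLinearEquiv.symm_apply_apply, ContinuousLinearEquiv.apply_symm_apply]
  by_cases hΛ : Summit.FinalStateConjecture.IsOrthochronous Λ
  · refine ⟨1, fun a y ↦ rfl, ?_⟩
    show 0 < (((Λ * 1 * Λ⁻¹)⁻¹ * Λ : lorentzGroup) : E4 ≃L[ℝ] E4) (E4.basisVector 0) 0
    rw [key]
    exact hΛ
  · obtain ⟨T, hT0, hTs⟩ := exists_timeReversal_mem_lorentzGroup
    refine ⟨T, fun a y ↦ kerrRadius_eq_of_spatial_eq a (hTs y), ?_⟩
    show 0 < (((Λ * T * Λ⁻¹)⁻¹ * Λ : lorentzGroup) : E4 ≃L[ℝ] E4) (E4.basisVector 0) 0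
    rw [key]
    have hTe : (T : E4 ≃L[ℝ] E4).symm (E4.basisVector 0) = -E4.basisVector 0 := by
      rw [ContinuousLinearEquiv.symm_apply_eq, map_neg, eq_neg_iff_add_eq_zero]
      ext μ
      refine Fin.cases ?_ (fun i ↦ ?_) μ
      · rw [PiLp.add_apply, hT0]; simp
      · have := congrArg (fun z : E3 ↦ z i) (hTs (E4.basisVector 0))
        simp only [E4.spatial_apply] at this
        rw [PiLp.add_apply, this]; simp [Fin.succ_ne_zero]
    rw [hTe, map_neg, PiLp.neg_apply]
    have hne := apply_basisVector_zero_ne_zero Λ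
    have hle : (Λ : E4 ≃L[ℝ] E4) (E4.basisVector 0) 0 ≤ 0 := not_lt.1 hΛ
    exact neg_pos.2 (lt_of_le_of_ne hle hne)

/-- **Rest-frame coordinates after the conjugated relabelling.** For the model Poincaré map
`P x = L x + p` with `L = Λ S Λ⁻¹`, `p = c − L c` (a discrete motion `S` conjugated into the frame of the
world-line `Λ ℝe₀ + c`, which it fixes), the rest-frame coordinates of the relabelled motion
`(L⁻¹Λ, L⁻¹(c − p))` are `S` applied to the old ones: `(L⁻¹Λ)⁻¹(x − L⁻¹(c − p)) = S (Λ⁻¹(x − c))`.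
O'Neill 1983, Ch. 9, p. 236. [cite: ONeill1983, Ch. 9  p. 236] -/
theorem poincareInv_relabel_conj (Λ S : lorentzGroup) (c x : E4) :
    poincareInv ((Λ * S * Λ⁻¹)⁻¹ * Λ)
        (((Λ * S * Λ⁻¹ : lorentzGroup) : E4 ≃L[ℝ] E4).symm
          (c - (c - ((Λ * S * Λ⁻¹ : lorentzGroup) : E4 ≃L[ℝ] E4) c))) x =
      (S : E4 ≃L[ℝ] E4) (poincareInv Λ c x) := by
  rw [poincareInv_relabel]
  simp only [poincareInv, affP]
  have hL : ∀ u : E4, ((Λ * S * Λ⁻¹ : lorentzGroup) : E4 ≃L[ℝ] E4) u =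
      (Λ : E4 ≃L[ℝ] E4) ((S : E4 ≃L[ℝ] E4) ((Λ : E4 ≃L[ℝ] E4).symm u)) := fun u ↦ rfl
  have : ((Λ * S * Λ⁻¹ : lorentzGroup) : E4 ≃L[ℝ] E4) x +
      (c - ((Λ * S * Λ⁻¹ : lorentzGroup) : E4 ≃L[ℝ] E4) c) - c =
      ((Λ * S * Λ⁻¹ : lorentzGroup) : E4 ≃L[ℝ] E4) (x - c) := by
    rw [map_sub]; abel
  rw [this, hL, ContinuousLinearEquiv.symm_apply_apply, map_sub]

/-- **Poincaré relabelling of late-chart data, clause by clause.** Let `(O', (Λᵢ, cᵢ), τ₀, Ψᵢ, ρᵢ, U₀,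
Φ, Rᵢ)` be late-chart data over a Cauchy development `𝒟` satisfying the twelve clauses of
`decomposition_of_lateCharts` other than orthochronicity, and let `Pᵢ x = Lᵢ x + pᵢ` be model Poincaré maps
(`Lᵢ ∈ O(1,3)`, `pᵢ ∈ E4`) such that (a) the rest-frame Kerr–Schild radius of the relabelled motion
`(Lᵢ⁻¹Λᵢ, Lᵢ⁻¹(cᵢ − pᵢ))` agrees with the old one at every point of `E4` and (b) the relabelled boosts
`Lᵢ⁻¹Λᵢ` are orthochronous. Then the relabelled data — same `O'`, `τ₀`, `ρ`, `U₀`, `Φ`, `R`, motions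
`(Lᵢ⁻¹Λᵢ, Lᵢ⁻¹(cᵢ − pᵢ))`, charts `Ψᵢ ∘ Pᵢ` — satisfy all thirteen clauses. Rest-frame time and radius
transform by precomposition with `Pᵢ` (`GapDecaySuffices.Negative.Relabel.time_relabel`, `radius_relabel`),
so chart images of `(t*ᵢ, rᵢ)`-defined model sets are unchanged (`image_comp_pre_setOf`: clauses 1, 3, 10),
late charts stay late charts (`isLateChart_comp_pre`: 2), `C²` norms on corresponding truncated slabs compare
with the finite constant `jetConst Lᵢ 2 = ‖Lᵢ‖² max(1, ‖Lᵢ‖)²` (`truncDeviationCk_comp_pre_le`: 9), clause 5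
is hypothesis (a), clause 11 is (b), and `d(Ψᵢ ∘ Pᵢ)ₓ((Lᵢ⁻¹Λᵢ) V) = (dΨᵢ)_{Pᵢx}(Λᵢ V)` with
`V = V_{Mᵢ,aᵢ}(Λᵢ⁻¹(Pᵢ x − cᵢ))` (`mfderiv_comp_pre_apply`, `poincareInv_relabel`: 12). O'Neill 1983, Ch. 9,
p. 236 (Poincaré motions of frames); Kerr–Schild 1965 (Lorentz covariance of the ansatz); DHRT
arXiv:2104.08222, §1. [cite: ONeill1983, Ch. 9  p. 236] -/
theorem lateCharts_relabel : ∀ {X : Type} [TopologicalSpace X] [ChartedSpace E3 X] [IsManifold (𝓡 3) ((⊤ : ℕ∞) : WithTop ℕ∞) X] [ConnectedSpace X] {D : InitialDataSet (𝓡 3) X} (𝒟 : CauchyDevelopment D) (N : ℕ) (M a : Fin N → ℝ), ∀ (O' : Set 𝒟.carrier) (mo : Fin N → lorentzGroup × E4) (τ₀ : ℝ) (Ψ : ∀ i, boostedKerrExterior (mo i).1 (mo i).2 (M i) (a i) → 𝒟.carrier) (ρ : Fin N → ℝ → ℝ) (U₀ : TopologicalSpace.Opens E4) (Φ : U₀ →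 𝒟.carrier) (R : Fin N → ℝ → ℝ) (L : Fin N → lorentzGroup) (p : Fin N → E4), (∀ i (x : E4), Kerr.radius (a i) (poincareInv ((L i)⁻¹ * (mo i).1) (((L i : lorentzGroup) : E4 ≃L[ℝ] E4).symm ((mo i).2 - p i)) x) = Kerr.radius (a i) (poincareInv (mo i).1 (mo i).2 x)) → (∀ i, Summit.FinalStateConjecture.IsOrthochronous ((L i)⁻¹ * (mo i).1)) → O' = Summit.FinalStateConjecture.exteriorOf 𝒟 (Φ '' (Minkowski.backgroundOn U₀).lateRegion τ₀ ∪ ⋃ i, Ψ i '' (boostedKerrBackground (mo i).1 (mo i).2 (M i) (a i)).lateRegion τ₀) → (∀ i, 𝒟.toSpacetime.IsLateChart (boostedKerrBackground (mo i).1 (mo i).2 (M i) (a i)) O' τ₀ (Ψ i)) → (∀ r : ℝ, ∃ τ₁ : ℝ, Pairwise (Function.onFun Disjoint fun i ↦ Ψ i '' (boostedKerrBackground (mo i).1 (mo i).2 (M i) (a i)).truncLateRegion τ₁ r)) → (∀ i, Tendsto (fun t ↦ ρ i t / t) atTop (𝓝 0)) → {x : E4 | τ₀ < x 0 ∧ ∀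 i, ρ i (x 0) < Kerr.radius (a i) (poincareInv (mo i).1 (mo i).2 x)} ⊆ (U₀ : Set E4) → 𝒟.toSpacetime.IsLateChart (Minkowski.backgroundOn U₀) O' τ₀ Φ → Tendsto (fun τ ↦ 𝒟.toSpacetime.deviationCk (Minkowski.backgroundOn U₀) Φ 2 τ) atTop (𝓝 0) → (∀ i, Tendsto (R i) atTop atTop ∧ ∀ τ, max (Kerr.rPlus (M i) (a i)) 0 + 1 ≤ R i τ) → (∀ i, Tendsto (fun τ ↦ 𝒟.toSpacetime.truncDeviationCk (boostedKerrBackground (mo i).1 (mo i).2 (M i) (a i)) (Ψ i) 2 (R i τ) τ) atTop (𝓝 0)) → (∀ τ₁ : ℝ, τ₀ ≤ τ₁ → O' \ (Φ '' (Minkowski.backgroundOn U₀).lateRegion τ₁ ∪ ⋃ i, Ψ i '' {x | τ₁ < (boostedKerrBackground (mo i).1 (mo i).2 (M i) (a i)).time x.1 ∧ (boostedKerrBackground (mo i).1 (mo i).2 (M i) (a i)).radius x.1 ≤ R i ((boostedKerrBackground (mo i).1 (mo i).2 (M i) (a i)).time x.1)}) ⊆ 𝒟.metric.causalPast 𝒟.timeOrientation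 (Φ '' (Minkowski.backgroundOn U₀).timeSlab τ₁ ∪ ⋃ i, Ψ i '' (boostedKerrBackground (mo i).1 (mo i).2 (M i) (a i)).truncTimeSlab (R i τ₁) τ₁)) → (∀ i (r : ℝ), ∀ᶠ τ in atTop, ∀ x ∈ (boostedKerrBackground (mo i).1 (mo i).2 (M i) (a i)).truncTimeSlab r τ, 𝒟.toSpacetime.timeOrientation.IsFutureDirected (mfderiv 𝓘(ℝ, E4) (𝓡 4) (Ψ i) x (((mo i).1 : E4 ≃L[ℝ] E4) (Kerr.timeVector (M i) (a i) (poincareInv (mo i).1 (mo i).2 (x : E4)))))) → (∀ᶠ τ in atTop, ∀ x ∈ (Minkowski.backgroundOn U₀).timeSlab τ, 𝒟.toSpacetime.timeOrientation.IsFutureDirected (mfderiv 𝓘(ℝ, E4) (𝓡 4) Φ x (E4.basisVector 0))) → O' = Summit.FinalStateConjecture.exteriorOf 𝒟 (Φ '' (Minkowski.backgroundOn U₀).lateRegion τ₀ ∪ ⋃ i, (Ψ i ∘ pre (mo i).1 (L i) (mo i).2 (p i) (M i) (a i)) '' (Bnew (mo i).1 (L i) (mo i).2 (p i) (M i) (a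 i)).lateRegion τ₀) ∧ (∀ i, 𝒟.toSpacetime.IsLateChart (Bnew (mo i).1 (L i) (mo i).2 (p i) (M i) (a i)) O' τ₀ (Ψ i ∘ pre (mo i).1 (L i) (mo i).2 (p i) (M i) (a i))) ∧ (∀ r : ℝ, ∃ τ₁ : ℝ, Pairwise (Function.onFun Disjoint fun i ↦ (Ψ i ∘ pre (mo i).1 (L i) (mo i).2 (p i) (M i) (a i)) '' (Bnew (mo i).1 (L i) (mo i).2 (p i) (M i) (a i)).truncLateRegion τ₁ r)) ∧ (∀ i, Tendsto (fun t ↦ ρ i t / t) atTop (𝓝 0)) ∧ {x : E4 | τ₀ < x 0 ∧ ∀ i, ρ i (x 0) < Kerr.radius (a i) (poincareInv ((L i)⁻¹ * (mo i).1) (((L i : lorentzGroup) : E4 ≃L[ℝ] E4).symm ((mo i).2 - p i)) x)} ⊆ (U₀ : Set E4) ∧ 𝒟.toSpacetime.IsLateChart (Minkowski.backgroundOn U₀) O' τ₀ Φ ∧ Tendsto (fun τ ↦ 𝒟.toSpacetime.deviationCk (Minkowski.backgroundOn U₀) Φ 2 τ) atTop (𝓝 0) ∧ (∀ i, Tendsto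 (R i) atTop atTop ∧ ∀ τ, max (Kerr.rPlus (M i) (a i)) 0 + 1 ≤ R i τ) ∧ (∀ i, Tendsto (fun τ ↦ 𝒟.toSpacetime.truncDeviationCk (Bnew (mo i).1 (L i) (mo i).2 (p i) (M i) (a i)) (Ψ i ∘ pre (mo i).1 (L i) (mo i).2 (p i) (M i) (a i)) 2 (R i τ) τ) atTop (𝓝 0)) ∧ (∀ τ₁ : ℝ, τ₀ ≤ τ₁ → O' \ (Φ '' (Minkowski.backgroundOn U₀).lateRegion τ₁ ∪ ⋃ i, (Ψ i ∘ pre (mo i).1 (L i) (mo i).2 (p i) (M i) (a i)) '' {x | τ₁ < (Bnew (mo i).1 (L i) (mo i).2 (p i) (M i) (a i)).time x.1 ∧ (Bnew (mo i).1 (L i) (mo i).2 (p i) (M i) (a i)).radius x.1 ≤ R i ((Bnew (mo i).1 (L i) (mo i).2 (p i) (M i) (a i)).time x.1)}) ⊆ 𝒟.metric.causalPast 𝒟.timeOrientation (Φ '' (Minkowski.backgroundOn U₀).timeSlab τ₁ ∪ ⋃ i, (Ψ i ∘ pre (mo i).1 (L i) (mo i).2 (p i) (M i) (a i)) '' (Bnew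 (mo i).1 (L i) (mo i).2 (p i) (M i) (a i)).truncTimeSlab (R i τ₁) τ₁)) ∧ (∀ i, Summit.FinalStateConjecture.IsOrthochronous ((L i)⁻¹ * (mo i).1)) ∧ (∀ i (r : ℝ), ∀ᶠ τ in atTop, ∀ x ∈ (Bnew (mo i).1 (L i) (mo i).2 (p i) (M i) (a i)).truncTimeSlab r τ, 𝒟.toSpacetime.timeOrientation.IsFutureDirected (mfderiv 𝓘(ℝ, E4) (𝓡 4) (Ψ i ∘ pre (mo i).1 (L i) (mo i).2 (p i) (M i) (a i)) x ((((L i)⁻¹ * (mo i).1 : lorentzGroup) : E4 ≃L[ℝ] E4) (Kerr.timeVector (M i) (a i) (poincareInv ((L i)⁻¹ * (mo i).1) (((L i : lorentzGroup) : E4 ≃L[ℝ] E4).symm ((mo i).2 - p i)) (x : E4)))))) ∧ (∀ᶠ τ in atTop, ∀ x ∈ (Minkowski.backgroundOn U₀).timeSlab τ, 𝒟.toSpacetime.timeOrientation.IsFutureDirected (mfderiv 𝓘(ℝ, E4) (𝓡 4) Φ x (E4.basisVector 0))) := by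
  intro X _ _ _ _ D 𝒟 N M a O' mo τ₀ Ψ ρ U₀ Φ R L p hrad horth hO' hlate hsep hexc hdom hflat hdev hR htrunc
    hcov hfutK hfutF
  refine ⟨?_, fun i ↦ isLateChart_comp_pre _ _ _ _ _ _ (hlate i), ?_, hexc, ?_, hflat, hdev, hR, ?_, ?_,
    horth, ?_, hfutF⟩
  · -- (1) the charted set is unchanged
    have e : ∀ i, (Ψ i ∘ pre (mo i).1 (L i) (mo i).2 (p i) (M i) (a i)) ''
        (Bnew (mo i).1 (L i) (mo i).2 (p i) (M i) (a i)).lateRegion τ₀ =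
        Ψ i '' (Bold (mo i).1 (mo i).2 (M i) (a i)).lateRegion τ₀ := fun i ↦
      image_comp_pre_setOf _ _ _ _ _ _ (Ψ i) fun t _ ↦ τ₀ < t
    rw [Set.iUnion_congr e]
    exact hO'
  · -- (3) separation: the truncated world-tubes are the same sets
    intro r
    obtain ⟨τ₁, h⟩ := hsep r
    refine ⟨τ₁, fun i j hij ↦ ?_⟩
    have e : ∀ i, (Ψ i ∘ pre (mo i).1 (L i) (mo i).2 (p i) (M i) (a i)) ''
        (Bnew (mo i).1 (L i) (mo i).2 (p i) (M i) (a i)).truncLateRegion τ₁ r =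
        Ψ i '' (Bold (mo i).1 (mo i).2 (M i) (a i)).truncLateRegion τ₁ r := fun i ↦
      image_comp_pre_setOf _ _ _ _ _ _ (Ψ i) fun t r' ↦ τ₁ < t ∧ r' ≤ r
    have := h hij
    simp only [Function.onFun] at this ⊢
    rw [e i, e j]
    exact this
  · -- (5) the flat domain clause: rest-frame radii agree by (a)
    rintro x ⟨hx0, hx⟩
    exact hdom ⟨hx0, fun i ↦ by rw [← hrad i x]; exact hx i⟩
  · -- (9) near-zone convergence out to `Rᵢ(τ)`: `C²` norms compare with the finite `jetConst Lᵢ 2`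
    intro i
    have hlim : Tendsto (fun τ ↦ jetConst (L i) 2 * 𝒟.toSpacetime.truncDeviationCk
        (Bold (mo i).1 (mo i).2 (M i) (a i)) (Ψ i) 2 (R i τ) τ) atTop (𝓝 0) := by
      have := ENNReal.Tendsto.const_mul (htrunc i) (Or.inr (jetConst_ne_top (L i) 2))
      simpa using this
    exact tendsto_of_tendsto_of_tendsto_of_le_of_le tendsto_const_nhds hlim (fun _ ↦ zero_le)
      fun τ ↦ truncDeviationCk_comp_pre_le (Ψ i) (hlate i).contMDiff 2 (R i τ) τ
  · -- (10) certified causal covering: certified late pieces and certified slabs are the same sets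
    intro τ₁ hτ₁
    have e1 : ∀ i, (Ψ i ∘ pre (mo i).1 (L i) (mo i).2 (p i) (M i) (a i)) ''
        {x | τ₁ < (Bnew (mo i).1 (L i) (mo i).2 (p i) (M i) (a i)).time x.1 ∧
          (Bnew (mo i).1 (L i) (mo i).2 (p i) (M i) (a i)).radius x.1 ≤
            R i ((Bnew (mo i).1 (L i) (mo i).2 (p i) (M i) (a i)).time x.1)} =
        Ψ i '' {x | τ₁ < (Bold (mo i).1 (mo i).2 (M i) (a i)).time x.1 ∧
          (Bold (mo i).1 (mo i).2 (M i) (a i)).radius x.1 ≤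
            R i ((Bold (mo i).1 (mo i).2 (M i) (a i)).time x.1)} := fun i ↦
      image_comp_pre_setOf _ _ _ _ _ _ (Ψ i) fun t r ↦ τ₁ < t ∧ r ≤ R i t
    have e2 : ∀ i, (Ψ i ∘ pre (mo i).1 (L i) (mo i).2 (p i) (M i) (a i)) ''
        (Bnew (mo i).1 (L i) (mo i).2 (p i) (M i) (a i)).truncTimeSlab (R i τ₁) τ₁ =
        Ψ i '' (Bold (mo i).1 (mo i).2 (M i) (a i)).truncTimeSlab (R i τ₁) τ₁ := fun i ↦
      image_comp_pre_setOf _ _ _ _ _ _ (Ψ i) fun t r ↦ t = τ₁ ∧ r ≤ R i τ₁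
    rw [Set.iUnion_congr e1, Set.iUnion_congr e2]
    exact hcov τ₁ hτ₁
  · -- (12) the pushed-forward background time vector is the old one at the corresponding point
    intro i r
    filter_upwards [hfutK i r] with τ hτ x hx
    have hx' : pre (mo i).1 (L i) (mo i).2 (p i) (M i) (a i) x ∈
        (Bold (mo i).1 (mo i).2 (M i) (a i)).truncTimeSlab r τ := by
      rw [ModelBackground.mem_truncTimeSlab] at hx ⊢
      change (Bold (mo i).1 (mo i).2 (M i) (a i)).time (affP (L i) (p i) x.1) = τ ∧
        (Bold (mo i).1 (mo i).2 (M i) (a i)).radius (affP (L i) (p i) x.1) ≤ r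
      rw [← time_relabel, ← radius_relabel]
      exact hx
    have key := hτ _ hx'
    have e : ∀ w, ((((L i)⁻¹ * (mo i).1 : lorentzGroup) : E4 ≃L[ℝ] E4)) w =
        ((L i : lorentzGroup) : E4 ≃L[ℝ] E4).symm (((mo i).1 : E4 ≃L[ℝ] E4) w) := fun w ↦ rfl
    -- chain rule through the model map (stated in the goal's own typing of `Ψᵢ ∘ Pᵢ`)
    have hm : ∀ w : E4, mfderiv 𝓘(ℝ, E4) (𝓡 4) (Ψ i ∘ pre (mo i).1 (L i) (mo i).2 (p i) (M i) (a i)) x w =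
        mfderiv 𝓘(ℝ, E4) (𝓡 4) (Ψ i) (pre (mo i).1 (L i) (mo i).2 (p i) (M i) (a i) x)
          (((L i : lorentzGroup) : E4 ≃L[ℝ] E4) w) :=
      fun w ↦ mfderiv_comp_pre_apply (Ψ i) (hlate i).contMDiff x w
    rw [hm, e, ContinuousLinearEquiv.apply_symm_apply, poincareInv_relabel]
    exact key

/-- **Orthochronous normalisation of late-chart data: the `IsOrthochronous` clause of the gluing stub is
free.** Late-chart data `(O', (Λᵢ, cᵢ), τ₀, Ψᵢ, ρᵢ, U₀, Φ, Rᵢ)` over a Cauchy development `𝒟` satisfying the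
twelve clauses of `decomposition_of_lateCharts` OTHER than orthochronicity of the motions (exterior
equation, late charts, separation, sublinear excision, flat domain, flat late chart, flat `C²` convergence,
honest radii, near-zone `C²` convergence out to `Rᵢ(τ)`, certified causal covering, eventual future-direction
of `dΨᵢ(Λᵢ V_{Mᵢ,aᵢ})` on truncated slabs and of `dΦ(∂₀)` on flat slabs) can be RELABELLED into data with new
motions and hole charts satisfying all thirteen, everything else (and the masses and spins) unchanged: hole
`i` is relabelled by `lateCharts_relabel` along `Pᵢ x = Lᵢ x + pᵢ` with `Lᵢ = Λᵢ Sᵢ Λᵢ⁻¹`, `pᵢ = cᵢ − Lᵢ cᵢ`,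
where `Sᵢ ∈ {1, T}` (`exists_orthochronous_conj`) is the identity if `Λᵢ` is orthochronous and the time
reversal otherwise — conjugated into the rest frame of the world-line `Λᵢ ℝe₀ + cᵢ`, which `Pᵢ` therefore
fixes; the new rest-frame coordinates are `Sᵢ` of the old ones (`poincareInv_relabel_conj`), so the
Kerr–Schild radius is unchanged (`r ∘ T = r`), and the new boost `Λᵢ Sᵢ⁻¹` is orthochronous because
`(Λᵢ e₀)⁰ ≠ 0`. Hence the structure `ApproximateKerrConfiguration`'s blindness to `Λ ↦ Λ·T` costs
nothing downstream of the gluing. O'Neill 1983, Ch. 9, pp. 233–236; DHRT arXiv:2104.08222, §1.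
[cite: ONeill1983, Ch. 9  pp. 233–236] -/
theorem lateCharts_orthochronous : ∀ {X : Type} [TopologicalSpace X] [ChartedSpace E3 X] [IsManifold (𝓡 3) ((⊤ : ℕ∞) : WithTop ℕ∞) X] [ConnectedSpace X] {D : InitialDataSet (𝓡 3) X} (𝒟 : CauchyDevelopment D) (N : ℕ) (M a : Fin N → ℝ), ∀ (O' : Set 𝒟.carrier) (mo : Fin N → lorentzGroup × E4) (τ₀ : ℝ) (Ψ : ∀ i, boostedKerrExterior (mo i).1 (mo i).2 (M i) (a i) → 𝒟.carrier) (ρ : Fin N → ℝ → ℝ) (U₀ : TopologicalSpace.Opens E4) (Φ : U₀ → 𝒟.carrier) (R : Fin N → ℝ → ℝ), O' = Summit.FinalStateConjecture.exteriorOf 𝒟 (Φ '' (Minkowski.backgroundOn U₀).lateRegion τ₀ ∪ ⋃ i, Ψ i '' (boostedKerrBackground (mo i).1 (mo i).2 (M i) (a i)).lateRegion τ₀) → (∀ i, 𝒟.toSpacetime.IsLateChart (boostedKerrBackground (mo i).1 (mo i).2 (M i) (a i)) O' τ₀ (Ψ i)) → (∀ r : ℝ, ∃ τ₁ : ℝ,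 Pairwise (Function.onFun Disjoint fun i ↦ Ψ i '' (boostedKerrBackground (mo i).1 (mo i).2 (M i) (a i)).truncLateRegion τ₁ r)) → (∀ i, Tendsto (fun t ↦ ρ i t / t) atTop (𝓝 0)) → {x : E4 | τ₀ < x 0 ∧ ∀ i, ρ i (x 0) < Kerr.radius (a i) (poincareInv (mo i).1 (mo i).2 x)} ⊆ (U₀ : Set E4) → 𝒟.toSpacetime.IsLateChart (Minkowski.backgroundOn U₀) O' τ₀ Φ → Tendsto (fun τ ↦ 𝒟.toSpacetime.deviationCk (Minkowski.backgroundOn U₀) Φ 2 τ) atTop (𝓝 0) → (∀ i, Tendsto (R i) atTop atTop ∧ ∀ τ, max (Kerr.rPlus (M i) (a i)) 0 + 1 ≤ R i τ) → (∀ i, Tendsto (fun τ ↦ 𝒟.toSpacetime.truncDeviationCk (boostedKerrBackground (mo i).1 (mo i).2 (M i) (a i)) (Ψ i) 2 (R i τ) τ) atTop (𝓝 0)) → (∀ τ₁ : ℝ, τ₀ ≤ τ₁ → O' \ (Φ '' (Minkowski.backgroundOn U₀).lateRegion τ₁ ∪ ⋃ i, Ψ i '' {x | τ₁ < (boostedKerrBackground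 (mo i).1 (mo i).2 (M i) (a i)).time x.1 ∧ (boostedKerrBackground (mo i).1 (mo i).2 (M i) (a i)).radius x.1 ≤ R i ((boostedKerrBackground (mo i).1 (mo i).2 (M i) (a i)).time x.1)}) ⊆ 𝒟.metric.causalPast 𝒟.timeOrientation (Φ '' (Minkowski.backgroundOn U₀).timeSlab τ₁ ∪ ⋃ i, Ψ i '' (boostedKerrBackground (mo i).1 (mo i).2 (M i) (a i)).truncTimeSlab (R i τ₁) τ₁)) → (∀ i (r : ℝ), ∀ᶠ τ in atTop, ∀ x ∈ (boostedKerrBackground (mo i).1 (mo i).2 (M i) (a i)).truncTimeSlab r τ, 𝒟.toSpacetime.timeOrientation.IsFutureDirected (mfderiv 𝓘(ℝ, E4) (𝓡 4) (Ψ i) x (((mo i).1 : E4 ≃L[ℝ] E4) (Kerr.timeVector (M i) (a i) (poincareInv (mo i).1 (mo i).2 (x : E4)))))) → (∀ᶠ τ in atTop, ∀ x ∈ (Minkowski.backgroundOn U₀).timeSlab τ, 𝒟.toSpacetime.timeOrientation.IsFutureDirected (mfderiv 𝓘(ℝ, E4) (𝓡 4) Φ x (E4.basisVector 0))) → ∃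 (mo' : Fin N → lorentzGroup × E4) (Ψ' : ∀ i, boostedKerrExterior (mo' i).1 (mo' i).2 (M i) (a i) → 𝒟.carrier), O' = Summit.FinalStateConjecture.exteriorOf 𝒟 (Φ '' (Minkowski.backgroundOn U₀).lateRegion τ₀ ∪ ⋃ i, Ψ' i '' (boostedKerrBackground (mo' i).1 (mo' i).2 (M i) (a i)).lateRegion τ₀) ∧ (∀ i, 𝒟.toSpacetime.IsLateChart (boostedKerrBackground (mo' i).1 (mo' i).2 (M i) (a i)) O' τ₀ (Ψ' i)) ∧ (∀ r : ℝ, ∃ τ₁ : ℝ, Pairwise (Function.onFun Disjoint fun i ↦ Ψ' i '' (boostedKerrBackground (mo' i).1 (mo' i).2 (M i) (a i)).truncLateRegion τ₁ r)) ∧ (∀ i, Tendsto (fun t ↦ ρ i t / t) atTop (𝓝 0)) ∧ {x : E4 | τ₀ < x 0 ∧ ∀ i, ρ i (x 0) < Kerr.radius (a i) (poincareInv (mo' i).1 (mo' i).2 x)} ⊆ (U₀ : Set E4) ∧ 𝒟.toSpacetime.IsLateChart (Minkowski.backgroundOn U₀) O' τ₀ Φ ∧ Tendsto (fun τ ↦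 𝒟.toSpacetime.deviationCk (Minkowski.backgroundOn U₀) Φ 2 τ) atTop (𝓝 0) ∧ (∀ i, Tendsto (R i) atTop atTop ∧ ∀ τ, max (Kerr.rPlus (M i) (a i)) 0 + 1 ≤ R i τ) ∧ (∀ i, Tendsto (fun τ ↦ 𝒟.toSpacetime.truncDeviationCk (boostedKerrBackground (mo' i).1 (mo' i).2 (M i) (a i)) (Ψ' i) 2 (R i τ) τ) atTop (𝓝 0)) ∧ (∀ τ₁ : ℝ, τ₀ ≤ τ₁ → O' \ (Φ '' (Minkowski.backgroundOn U₀).lateRegion τ₁ ∪ ⋃ i, Ψ' i '' {x | τ₁ < (boostedKerrBackground (mo' i).1 (mo' i).2 (M i) (a i)).time x.1 ∧ (boostedKerrBackground (mo' i).1 (mo' i).2 (M i) (a i)).radius x.1 ≤ R i ((boostedKerrBackground (mo' i).1 (mo' i).2 (M i) (a i)).time x.1)}) ⊆ 𝒟.metric.causalPast 𝒟.timeOrientation (Φ '' (Minkowski.backgroundOn U₀).timeSlab τ₁ ∪ ⋃ i, Ψ' i '' (boostedKerrBackground (mo' i).1 (mo' i).2 (M i) (a i)).truncTimeSlab (R i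 τ₁) τ₁)) ∧ (∀ i, Summit.FinalStateConjecture.IsOrthochronous (mo' i).1) ∧ (∀ i (r : ℝ), ∀ᶠ τ in atTop, ∀ x ∈ (boostedKerrBackground (mo' i).1 (mo' i).2 (M i) (a i)).truncTimeSlab r τ, 𝒟.toSpacetime.timeOrientation.IsFutureDirected (mfderiv 𝓘(ℝ, E4) (𝓡 4) (Ψ' i) x (((mo' i).1 : E4 ≃L[ℝ] E4) (Kerr.timeVector (M i) (a i) (poincareInv (mo' i).1 (mo' i).2 (x : E4)))))) ∧ (∀ᶠ τ in atTop, ∀ x ∈ (Minkowski.backgroundOn U₀).timeSlab τ, 𝒟.toSpacetime.timeOrientation.IsFutureDirected (mfderiv 𝓘(ℝ, E4) (𝓡 4) Φ x (E4.basisVector 0))) := by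
  intro X _ _ _ _ D 𝒟 N M a O' mo τ₀ Ψ ρ U₀ Φ R hO' hlate hsep hexc hdom hflat hdev hR htrunc hcov
    hfutK hfutF
  -- per hole: a discrete `Sᵢ ∈ {1, T}` keeping the Kerr–Schild radius with `Λᵢ Sᵢ⁻¹` orthochronous
  choose S hSr hSo using fun i ↦ exists_orthochronous_conj (mo i).1
  exact ⟨fun i ↦ ((((mo i).1 * S i * (mo i).1⁻¹)⁻¹ * (mo i).1),
      ((((mo i).1 * S i * (mo i).1⁻¹ : lorentzGroup) : E4 ≃L[ℝ] E4).symm ((mo i).2 - ((mo i).2 -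
        ((((mo i).1 * S i * (mo i).1⁻¹ : lorentzGroup) : E4 ≃L[ℝ] E4) (mo i).2))))),
    fun i ↦ Ψ i ∘ pre (mo i).1 ((mo i).1 * S i * (mo i).1⁻¹) (mo i).2
      ((mo i).2 - ((((mo i).1 * S i * (mo i).1⁻¹ : lorentzGroup) : E4 ≃L[ℝ] E4) (mo i).2)) (M i) (a i),
    lateCharts_relabel 𝒟 N M a O' mo τ₀ Ψ ρ U₀ Φ R (fun i ↦ (mo i).1 * S i * (mo i).1⁻¹)
      (fun i ↦ (mo i).2 - ((((mo i).1 * S i * (mo i).1⁻¹ : lorentzGroup) : E4 ≃L[ℝ] E4) (mo i).2))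
      (fun i x ↦ (congrArg (Kerr.radius (a i)) (poincareInv_relabel_conj (mo i).1 (S i) (mo i).2 x)).trans
        (hSr i (a i) _))
      hSo hO' hlate hsep hexc hdom hflat hdev hR htrunc hcov hfutK hfutF⟩

/-- **Packaging `N + 1` late charts WITHOUT the orthochronicity clause.** `decomposition_of_lateCharts`
(p151942) with its hypothesis `∀ i, IsOrthochronous (Λᵢ)` removed: the remaining twelve clauses already give
a `C²` `FinalStateDecomposition d` of the same `O'` with `d.N = N`, labels `(M, a)`,
`O' = exteriorOf 𝒟 d.charted`, `HasExhaustiveCharts d` and `IsFutureOriented d` (relabel by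
`lateCharts_orthochronous`, then package). Dafermos–Luk arXiv:1710.01722, Conjecture 1 (b)–(c); O'Neill
1983, Ch. 9. [cite: DafermosLuk2017, Conjecture 1 (b)–(c)] -/
theorem decomposition_of_unorientedLateCharts : ∀ {X : Type} [TopologicalSpace X] [ChartedSpace E3 X] [IsManifold (𝓡 3) ((⊤ : ℕ∞) : WithTop ℕ∞) X] [ConnectedSpace X] {D : InitialDataSet (𝓡 3) X} (𝒟 : CauchyDevelopment D) (N : ℕ) (M a : Fin N → ℝ), (∀ j, 0 < M j) → (∀ j, |a j| ≤ M j) → ∀ (O' : Set 𝒟.carrier) (mo : Fin N → lorentzGroup × E4) (τ₀ : ℝ) (Ψ : ∀ i, boostedKerrExterior (mo i).1 (mo i).2 (M i) (a i) → 𝒟.carrier) (ρ : Fin N → ℝ → ℝ) (U₀ : TopologicalSpace.Opens E4) (Φ : U₀ → 𝒟.carrier) (R : Fin N → ℝ → ℝ), O' = Summit.FinalStateConjecture.exteriorOf 𝒟 (Φ '' (Minkowski.backgroundOn U₀).lateRegion τ₀ ∪ ⋃ i, Ψ i '' (boostedKerrBackground (mo i).1 (mo i).2 (M i) (a i)).lateRegion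 τ₀) → (∀ i, 𝒟.toSpacetime.IsLateChart (boostedKerrBackground (mo i).1 (mo i).2 (M i) (a i)) O' τ₀ (Ψ i)) → (∀ r : ℝ, ∃ τ₁ : ℝ, Pairwise (Function.onFun Disjoint fun i ↦ Ψ i '' (boostedKerrBackground (mo i).1 (mo i).2 (M i) (a i)).truncLateRegion τ₁ r)) → (∀ i, Tendsto (fun t ↦ ρ i t / t) atTop (𝓝 0)) → {x : E4 | τ₀ < x 0 ∧ ∀ i, ρ i (x 0) < Kerr.radius (a i) (poincareInv (mo i).1 (mo i).2 x)} ⊆ (U₀ : Set E4) → 𝒟.toSpacetime.IsLateChart (Minkowski.backgroundOn U₀) O' τ₀ Φ → Tendsto (fun τ ↦ 𝒟.toSpacetime.deviationCk (Minkowski.backgroundOn U₀) Φ 2 τ) atTop (𝓝 0) → (∀ i, Tendsto (R i) atTop atTop ∧ ∀ τ, max (Kerr.rPlus (M i) (a i)) 0 + 1 ≤ R i τ) → (∀ i, Tendsto (fun τ ↦ 𝒟.toSpacetime.truncDeviationCk (boostedKerrBackground (mo i).1 (mo i).2 (M i) (a i)) (Ψ i) 2 (R i τ) τ) atTop (𝓝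 0)) → (∀ τ₁ : ℝ, τ₀ ≤ τ₁ → O' \ (Φ '' (Minkowski.backgroundOn U₀).lateRegion τ₁ ∪ ⋃ i, Ψ i '' {x | τ₁ < (boostedKerrBackground (mo i).1 (mo i).2 (M i) (a i)).time x.1 ∧ (boostedKerrBackground (mo i).1 (mo i).2 (M i) (a i)).radius x.1 ≤ R i ((boostedKerrBackground (mo i).1 (mo i).2 (M i) (a i)).time x.1)}) ⊆ 𝒟.metric.causalPast 𝒟.timeOrientation (Φ '' (Minkowski.backgroundOn U₀).timeSlab τ₁ ∪ ⋃ i, Ψ i '' (boostedKerrBackground (mo i).1 (mo i).2 (M i) (a i)).truncTimeSlab (R i τ₁) τ₁)) → (∀ i (r : ℝ), ∀ᶠ τ in atTop, ∀ x ∈ (boostedKerrBackground (mo i).1 (mo i).2 (M i) (a i)).truncTimeSlab r τ, 𝒟.toSpacetime.timeOrientation.IsFutureDirected (mfderiv 𝓘(ℝ, E4) (𝓡 4) (Ψ i) x (((mo i).1 : E4 ≃L[ℝ] E4) (Kerr.timeVector (M i) (a i) (poincareInv (mo i).1 (mo i).2 (x : E4)))))) → (∀ᶠ τ in atTop, ∀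 x ∈ (Minkowski.backgroundOn U₀).timeSlab τ, 𝒟.toSpacetime.timeOrientation.IsFutureDirected (mfderiv 𝓘(ℝ, E4) (𝓡 4) Φ x (E4.basisVector 0))) → ∃ d : FinalStateDecomposition 𝒟.toSpacetime O' 2, d.N = N ∧ (∀ (i : Fin d.N) (j : Fin N), (i : ℕ) = (j : ℕ) → d.mass i = M j ∧ d.spin i = a j) ∧ O' = Summit.FinalStateConjecture.exteriorOf 𝒟 d.charted ∧ Summit.FinalStateConjecture.HasExhaustiveCharts d ∧ Summit.FinalStateConjecture.IsFutureOriented d := by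
  intro X _ _ _ _ D 𝒟 N M a hM ha O' mo τ₀ Ψ ρ U₀ Φ R hO' hlate hsep hexc hdom hflat hdev hR htrunc hcov
    hfutK hfutF
  obtain ⟨mo', Ψ', h1, h2, h3, h4, h5, h6, h7, h8, h9, h10, h11, h12, h13⟩ :=
    lateCharts_orthochronous 𝒟 N M a O' mo τ₀ Ψ ρ U₀ Φ R hO' hlate hsep hexc hdom hflat hdev hR htrunc
      hcov hfutK hfutF
  exact decomposition_of_lateCharts 𝒟 N M a hM ha O' mo' τ₀ Ψ' ρ U₀ Φ R h1 h2 h3 h4 h5 h6 h7 h8 h9 h10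
    h11 h12 h13

/-- **The gluing stub may drop its orthochronicity clause.** The registered stub
`stub_lateChartsOfPinnedTracking` of the skeleton `Cruxes/DriftCapture/Lines/birth.lean` (v4: eventually
pinned tracking of window length `1` at every `δ` and accuracy ⇒ the thirteen packaging clauses) follows
VERBATIM from the same statement with the clause `∀ i, IsOrthochronous (mo i).1` deleted from its
conclusion (twelve clauses), by `lateCharts_orthochronous`. [cite: ONeill1983, Ch. 9  pp. 233–236] -/
theorem lateChartsOfPinnedTracking_of_unoriented : (∀ (N : ℕ) (m₀ χ : ℝ), 0 < N → m₀ ≤ 1 → 0 < m₀ → 0 ≤ χ → χ < 1 → ∀ (X : Type) [TopologicalSpace X] [ChartedSpace E3 X] [IsManifold (𝓡 3) ((⊤ : ℕ∞) : WithTop ℕ∞) X] [T2Space X] [SecondCountableTopology X] [ConnectedSpace X], ∀ D ∈ admissibleVacuumData X, ∀ 𝒟 : VacuumCauchyDevelopment D, 𝒟.IsMaximal → Summit.FinalStateConjecture.HasCompleteNullInfinity 𝒟.toCauchyDevelopment → ∀ (M a : Fin N → ℝ) (Λ : Fin N → lorentzGroup), (∀ j, m₀ ≤ M j ∧ M j ≤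 m₀⁻¹ ∧ |a j| ≤ χ * M j) → (∀ δ : ℝ, 0 < δ → ∀ (ε : ENNReal) (R₀ : ℝ), 0 < ε → ∃ (R : ℕ → ℝ) (O : Set 𝒟.carrier) (c : ∀ n : ℕ, ApproximateKerrConfiguration 𝒟.toSpacetime O 2 ε 0 1 (R n)), (∀ n, R₀ ≤ R n) ∧ Tendsto R atTop atTop ∧ (∀ n, (c n).N = N) ∧ (∀ n (i : Fin (c n).N), m₀ ≤ (c n).mass i ∧ (c n).mass i ≤ m₀⁻¹ ∧ |(c n).spin i| ≤ χ * (c n).mass i) ∧ (∀ n, (c (n + 1)).certifiedSlab 0 ⊆ (c n).windowImage) ∧ (∀ K : Set 𝒟.carrier, IsCompact K → ∃ n₀ : ℕ, ∀ n, n₀ ≤ n → Disjoint (c n).windowImage (𝒟.metric.causalPast 𝒟.timeOrientation K)) ∧ O = 𝒟.toCauchyDevelopment.exteriorOf (⋃ n, (c n).windowImage) ∧ O ⊆ 𝒟.metric.causalPast 𝒟.timeOrientation ((c 0).certifiedSlab 0) ∪ ⋃ n, (c n).windowImage ∧ ∃ n₀ : ℕ, ∀ n, n₀ ≤ n → ∀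 (i : Fin (c n).N) (j : Fin N), (i : ℕ) = (j : ℕ) → |(c n).mass i - M j| ≤ δ ∧ |(c n).spin i - a j| ≤ δ ∧ ‖((((c n).motion i).1 : E4 ≃L[ℝ] E4) : E4 →L[ℝ] E4) - (((Λ j : E4 ≃L[ℝ] E4)) : E4 →L[ℝ] E4)‖ ≤ δ) → ∃ (O' : Set 𝒟.carrier) (mo : Fin N → lorentzGroup × E4) (τ₀ : ℝ) (Ψ : ∀ i, boostedKerrExterior (mo i).1 (mo i).2 (M i) (a i) → 𝒟.carrier) (ρ : Fin N → ℝ → ℝ) (U₀ : TopologicalSpace.Opens E4) (Φ : U₀ → 𝒟.carrier) (R : Fin N → ℝ → ℝ), O' = Summit.FinalStateConjecture.exteriorOf 𝒟.toCauchyDevelopment (Φ '' (Minkowski.backgroundOn U₀).lateRegion τ₀ ∪ ⋃ i, Ψ i '' (boostedKerrBackground (mo i).1 (mo i).2 (M i) (a i)).lateRegion τ₀) ∧ (∀ i, 𝒟.toSpacetime.IsLateChart (boostedKerrBackground (mo i).1 (mo i).2 (M i) (a i)) O' τ₀ (Ψ i)) ∧ (∀ r : ℝ, ∃ τ₁ :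 ℝ, Pairwise (Function.onFun Disjoint fun i ↦ Ψ i '' (boostedKerrBackground (mo i).1 (mo i).2 (M i) (a i)).truncLateRegion τ₁ r)) ∧ (∀ i, Tendsto (fun t ↦ ρ i t / t) atTop (𝓝 0)) ∧ {x : E4 | τ₀ < x 0 ∧ ∀ i, ρ i (x 0) < Kerr.radius (a i) (poincareInv (mo i).1 (mo i).2 x)} ⊆ (U₀ : Set E4) ∧ 𝒟.toSpacetime.IsLateChart (Minkowski.backgroundOn U₀) O' τ₀ Φ ∧ Tendsto (fun τ ↦ 𝒟.toSpacetime.deviationCk (Minkowski.backgroundOn U₀) Φ 2 τ) atTop (𝓝 0) ∧ (∀ i, Tendsto (R i) atTop atTop ∧ ∀ τ, max (Kerr.rPlus (M i) (a i)) 0 + 1 ≤ R i τ) ∧ (∀ i, Tendsto (fun τ ↦ 𝒟.toSpacetime.truncDeviationCk (boostedKerrBackground (mo i).1 (mo i).2 (M i) (a i)) (Ψ i) 2 (R i τ) τ) atTop (𝓝 0)) ∧ (∀ τ₁ : ℝ, τ₀ ≤ τ₁ → O' \ (Φ '' (Minkowski.backgroundOn U₀).lateRegion τ₁ ∪ ⋃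 i, Ψ i '' {x | τ₁ < (boostedKerrBackground (mo i).1 (mo i).2 (M i) (a i)).time x.1 ∧ (boostedKerrBackground (mo i).1 (mo i).2 (M i) (a i)).radius x.1 ≤ R i ((boostedKerrBackground (mo i).1 (mo i).2 (M i) (a i)).time x.1)}) ⊆ 𝒟.metric.causalPast 𝒟.timeOrientation (Φ '' (Minkowski.backgroundOn U₀).timeSlab τ₁ ∪ ⋃ i, Ψ i '' (boostedKerrBackground (mo i).1 (mo i).2 (M i) (a i)).truncTimeSlab (R i τ₁) τ₁)) ∧ (∀ i (r : ℝ), ∀ᶠ τ in atTop, ∀ x ∈ (boostedKerrBackground (mo i).1 (mo i).2 (M i) (a i)).truncTimeSlab r τ, 𝒟.toSpacetime.timeOrientation.IsFutureDirected (mfderiv 𝓘(ℝ, E4) (𝓡 4) (Ψ i) x (((mo i).1 : E4 ≃L[ℝ] E4) (Kerr.timeVector (M i) (a i) (poincareInv (mo i).1 (mo i).2 (x : E4)))))) ∧ ∀ᶠ τ in atTop, ∀ x ∈ (Minkowski.backgroundOn U₀).timeSlab τ, 𝒟.toSpacetime.timeOrientation.IsFutureDirected (mfderiv 𝓘(ℝ,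 E4) (𝓡 4) Φ x (E4.basisVector 0))) → ∀ (N : ℕ) (m₀ χ : ℝ), 0 < N → m₀ ≤ 1 → 0 < m₀ → 0 ≤ χ → χ < 1 → ∀ (X : Type) [TopologicalSpace X] [ChartedSpace E3 X] [IsManifold (𝓡 3) ((⊤ : ℕ∞) : WithTop ℕ∞) X] [T2Space X] [SecondCountableTopology X] [ConnectedSpace X], ∀ D ∈ admissibleVacuumData X, ∀ 𝒟 : VacuumCauchyDevelopment D, 𝒟.IsMaximal → Summit.FinalStateConjecture.HasCompleteNullInfinity 𝒟.toCauchyDevelopment → ∀ (M a : Fin N → ℝ) (Λ : Fin N → lorentzGroup), (∀ j, m₀ ≤ M j ∧ M j ≤ m₀⁻¹ ∧ |a j| ≤ χ * M j) → (∀ δ : ℝ, 0 < δ → ∀ (ε : ENNReal) (R₀ : ℝ), 0 < ε → ∃ (R : ℕ → ℝ) (O : Set 𝒟.carrier) (c : ∀ n : ℕ, ApproximateKerrConfiguration 𝒟.toSpacetime O 2 ε 0 1 (R n)), (∀ n, R₀ ≤ R n) ∧ Tendsto R atTop atTop ∧ (∀ n, (c n).N = N) ∧ (∀ n (i : Fin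 (c n).N), m₀ ≤ (c n).mass i ∧ (c n).mass i ≤ m₀⁻¹ ∧ |(c n).spin i| ≤ χ * (c n).mass i) ∧ (∀ n, (c (n + 1)).certifiedSlab 0 ⊆ (c n).windowImage) ∧ (∀ K : Set 𝒟.carrier, IsCompact K → ∃ n₀ : ℕ, ∀ n, n₀ ≤ n → Disjoint (c n).windowImage (𝒟.metric.causalPast 𝒟.timeOrientation K)) ∧ O = 𝒟.toCauchyDevelopment.exteriorOf (⋃ n, (c n).windowImage) ∧ O ⊆ 𝒟.metric.causalPast 𝒟.timeOrientation ((c 0).certifiedSlab 0) ∪ ⋃ n, (c n).windowImage ∧ ∃ n₀ : ℕ, ∀ n, n₀ ≤ n → ∀ (i : Fin (c n).N) (j : Fin N), (i : ℕ) = (j : ℕ) → |(c n).mass i - M j| ≤ δ ∧ |(c n).spin i - a j| ≤ δ ∧ ‖((((c n).motion i).1 : E4 ≃L[ℝ] E4) : E4 →L[ℝ] E4) - (((Λ j : E4 ≃L[ℝ] E4)) : E4 →L[ℝ] E4)‖ ≤ δ) → ∃ (O' : Set 𝒟.carrier) (mo : Fin N → lorentzGroup × E4) (τ₀ : ℝ)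 (Ψ : ∀ i, boostedKerrExterior (mo i).1 (mo i).2 (M i) (a i) → 𝒟.carrier) (ρ : Fin N → ℝ → ℝ) (U₀ : TopologicalSpace.Opens E4) (Φ : U₀ → 𝒟.carrier) (R : Fin N → ℝ → ℝ), O' = Summit.FinalStateConjecture.exteriorOf 𝒟.toCauchyDevelopment (Φ '' (Minkowski.backgroundOn U₀).lateRegion τ₀ ∪ ⋃ i, Ψ i '' (boostedKerrBackground (mo i).1 (mo i).2 (M i) (a i)).lateRegion τ₀) ∧ (∀ i, 𝒟.toSpacetime.IsLateChart (boostedKerrBackground (mo i).1 (mo i).2 (M i) (a i)) O' τ₀ (Ψ i)) ∧ (∀ r : ℝ, ∃ τ₁ : ℝ, Pairwise (Function.onFun Disjoint fun i ↦ Ψ i '' (boostedKerrBackground (mo i).1 (mo i).2 (M i) (a i)).truncLateRegion τ₁ r)) ∧ (∀ i, Tendsto (fun t ↦ ρ i t / t) atTop (𝓝 0)) ∧ {x : E4 | τ₀ < x 0 ∧ ∀ i, ρ i (x 0) < Kerr.radius (a i) (poincareInv (mo i).1 (mo i).2 x)} ⊆ (U₀ : Set E4) ∧ 𝒟.toSpacetime.IsLateChart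 (Minkowski.backgroundOn U₀) O' τ₀ Φ ∧ Tendsto (fun τ ↦ 𝒟.toSpacetime.deviationCk (Minkowski.backgroundOn U₀) Φ 2 τ) atTop (𝓝 0) ∧ (∀ i, Tendsto (R i) atTop atTop ∧ ∀ τ, max (Kerr.rPlus (M i) (a i)) 0 + 1 ≤ R i τ) ∧ (∀ i, Tendsto (fun τ ↦ 𝒟.toSpacetime.truncDeviationCk (boostedKerrBackground (mo i).1 (mo i).2 (M i) (a i)) (Ψ i) 2 (R i τ) τ) atTop (𝓝 0)) ∧ (∀ τ₁ : ℝ, τ₀ ≤ τ₁ → O' \ (Φ '' (Minkowski.backgroundOn U₀).lateRegion τ₁ ∪ ⋃ i, Ψ i '' {x | τ₁ < (boostedKerrBackground (mo i).1 (mo i).2 (M i) (a i)).time x.1 ∧ (boostedKerrBackground (mo i).1 (mo i).2 (M i) (a i)).radius x.1 ≤ R i ((boostedKerrBackground (mo i).1 (mo i).2 (M i) (a i)).time x.1)}) ⊆ 𝒟.metric.causalPast 𝒟.timeOrientation (Φ '' (Minkowski.backgroundOn U₀).timeSlab τ₁ ∪ ⋃ i, Ψ i '' (boostedKerrBackground (mo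 i).1 (mo i).2 (M i) (a i)).truncTimeSlab (R i τ₁) τ₁)) ∧ (∀ i, Summit.FinalStateConjecture.IsOrthochronous (mo i).1) ∧ (∀ i (r : ℝ), ∀ᶠ τ in atTop, ∀ x ∈ (boostedKerrBackground (mo i).1 (mo i).2 (M i) (a i)).truncTimeSlab r τ, 𝒟.toSpacetime.timeOrientation.IsFutureDirected (mfderiv 𝓘(ℝ, E4) (𝓡 4) (Ψ i) x (((mo i).1 : E4 ≃L[ℝ] E4) (Kerr.timeVector (M i) (a i) (poincareInv (mo i).1 (mo i).2 (x : E4)))))) ∧ ∀ᶠ τ in atTop, ∀ x ∈ (Minkowski.backgroundOn U₀).timeSlab τ, 𝒟.toSpacetime.timeOrientation.IsFutureDirected (mfderiv 𝓘(ℝ, E4) (𝓡 4) Φ x (E4.basisVector 0)) := by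
  intro H N m₀ χ hN hm₁ hm₀ hχ₀ hχ₁ X _ _ _ _ _ _ D hD 𝒟 hmax hscri M a Λ hbox hpin
  obtain ⟨O', mo, τ₀, Ψ, ρ, U₀, Φ, R, hO', hlate, hsep, hexc, hdom, hflat, hdev, hR, htrunc, hcov,
    hfutK, hfutF⟩ := H N m₀ χ hN hm₁ hm₀ hχ₀ hχ₁ X D hD 𝒟 hmax hscri M a Λ hbox hpin
  obtain ⟨mo', Ψ', h⟩ := lateCharts_orthochronous 𝒟.toCauchyDevelopment N M a O' mo τ₀ Ψ ρ U₀ Φ R hO'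
    hlate hsep hexc hdom hflat hdev hR htrunc hcov hfutK hfutF
  exact ⟨O', mo', τ₀, Ψ', ρ, U₀, Φ, R, h⟩

end Summit.FinalStateConjecture.FinalStateConjecture.Theorems.RenormalisedDrift.DriftCapture

end
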